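import Summits.HodgeConjecture.CorCM.Census.CoinvariantOddHalf
import Summits.HodgeConjecture.CorCM.FaceCoinvariantFloor
import HarnessLib

/-!
# The face-coinvariant floor, degree `2·odd`: `φ₂(F) = β(F) − 1`

COR-CM (cell `pub-hodgecm2`), count-neutral kernel combinatorics by the binder seat b09 (gen 29; lane COINVARIANT-FLOOR, addendum):
the intrinsic form, for a Galois CM field `F`, of `Census/CoinvariantOddHalf.lean` (X); sequel of `CorCM/FaceCoinvariantFloor.lean`.
Theorems only; no `decide`, no certificate, no named fact, no `sorry`.  HONEST FRAMING: `HC_CM` is NOT proved; nothing here is a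
period.  T5: n/a-class (no named-fact / conjecture-def binder).

THE STATEMENT (`fibreTwo_add_one_eq_card_block_of_odd_finrank_div_two`).  For every Galois CM field `F` whose degree `[F:ℚ] = 2n`
has `n` ODD (degrees `6, 10, 14, 18, 22, 26, 30, …`; `Gal(F/ℚ) ≅ C₂ × A`, `|A| = n` odd, abelian or not): **`φ₂(F) + 1 = β(F)`** — a
face-period route for `F` needs at least `β(F) − 1` faces (`β(F)` = number of isogeny classes of simple CM abelian varieties whose CM
is split by `F`), and `β(F) − 1` is exactly the coinvariant fibre `dim_𝔽₂ (Λ_F ⊗ 𝔽₂)_{Gal}`; with the hgen floor of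
`FaceCoinvariantFloor` this is the census-free form of b17's odd-degree parity law in the coinvariant currency.

## References
* [Pohlmann1968] H. Pohlmann, Algebraic cycles on abelian varieties of complex multiplication type, Ann. of Math. 88 (1968), Thm 1.
* [Milne1999] J. S. Milne, Lefschetz motives and the Tate conjecture, Compositio Math. 117 (1999), Prop. 2.1, p. 54.
-/

noncomputable section

open NumberField NumberField.ComplexEmbedding

namespace Summit.HodgeConjecture.CorCM.FaceCoinvariant

open Literature.AlgebraicGeometry.Motives (CMType)
open Summit.HodgeConjecture.CorCM.Prior.AllgGroup.RfwfAllgGroup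
open Summit.HodgeConjecture.CorCM.Census.BlockParity
open Summit.HodgeConjecture.CorCM.Census.Coinvariant

variable {F : Type} [Field F] [NumberField F]

/-- **Degree `2·odd`: `φ₂(F) + 1 = β(F)`** — the coinvariant floor of a Galois CM field of degree `2n`, `n` odd, is the number of
blocks minus one. [folklore] -/
theorem fibreTwo_add_one_eq_card_block_of_odd_finrank_div_two [IsCMField F] [IsGalois ℚ F]
    (hodd : Odd (Module.finrank ℚ F / 2)) :
    fibreTwo (conjT : GalT F) conjT_mul_self + 1 = Fintype.card (Block (conjT : GalT F)) :=
  Census.Coinvariant.fibreTwo_add_one_eq_card_block_of_odd_half conjT conjT_mul_self conjT_ne_one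
    (fun P => FaceBasis.conjT_comm P) (by rw [FaceCensus.card_galT]; exact hodd)

/-- **… with an `hgen` set of faces** (degree `2n`, `n` odd): `β(F) ≤ |𝒮| + 1` and this is exactly the coinvariant floor
(`φ₂(F) = β(F) − 1 ≤ |𝒮|`). [folklore] -/
theorem card_block_le_card_add_one_of_hgen_of_odd [IsCMField F] [IsGalois ℚ F] (hodd : Odd (Module.finrank ℚ F / 2))
    (𝒮 : Finset (Face F)) (σ₀ : F →+* ℂ)
    (hgen : ∀ f : Face F, lefChar f.corner (fun _ => ({σ₀} : Finset (F →+* ℂ))) ∈ AddSubgroup.closure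
      {a : Asym F | ∃ g ∈ (𝒮 : Set (Face F)), ∃ σ : F →+* ℂ, a = lefChar g.corner (fun _ => ({σ} : Finset (F →+* ℂ)))}) :
    Fintype.card (Block (conjT : GalT F)) ≤ 𝒮.card + 1 ∧ fibreTwo (conjT : GalT F) conjT_mul_self ≤ 𝒮.card := by
  have h1 := fibreTwo_le_card_of_hgen 𝒮 σ₀ hgen
  have h2 := fibreTwo_add_one_eq_card_block_of_odd_finrank_div_two hodd
  exact ⟨by omega, h1⟩

/-- **Degree `2·odd`: the two floors coincide**, `φ₂(F) = dim_𝔽₂ span par(faces)`. [folklore] -/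
theorem fibreTwo_eq_finrank_span_par_of_odd_finrank_div_two [IsCMField F] [IsGalois ℚ F]
    (hodd : Odd (Module.finrank ℚ F / 2)) :
    fibreTwo (conjT : GalT F) conjT_mul_self =
      Module.finrank (ZMod 2) ↥(Submodule.span (ZMod 2) (par (conjT : GalT F) '' gfaceSet (GalT F) conjT conjT_mul_self)) :=
  Census.Coinvariant.fibreTwo_eq_finrank_span_par_of_odd_half conjT conjT_mul_self conjT_ne_one
    (fun P => FaceBasis.conjT_comm P) (by rw [FaceCensus.card_galT]; exact hodd)

end Summit.HodgeConjecture.CorCM.FaceCoinvariant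

end
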